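import Literature.AlgebraicGeometry.Morphisms.FlatProjectiveFamilyHilbertPolynomialLocallyConstantScheme
import Literature.AlgebraicGeometry.Morphisms.GraphFamilyBaseChange
import HarnessLib

/-!
# The Hilbert polynomial of the graph of a `T`-morphism `Y_T → X_T`: a locally constant, admissible function on `T`

Layer `Literature/AlgebraicGeometry/Morphisms`, namespace `Literature.AlgebraicGeometry.Morphisms`.  Theorems only: no definition, no
named fact, no instance, no notation, no `sorry`.  Universe `0`.

For `q : Y → S` FLAT, `p : X → S`, a closed `S`-embedding `jW : Y ×_S X ↪ 𝐏(ι; S)` (`#ι ≥ 1`), `T` locally Noetherian over `S` via `v` and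
a `T`-morphism `φ : Y_T → X_T` with graph family `iΓ : Y_T ↪ 𝐏(ι; T)` (★ `Morphisms/GraphFamilyBaseChange` §5):

* **`graphFamily_hilbertPolynomial_decomposition`** — there is a LOCALLY CONSTANT `P : T → ℚ[X]` whose values are ADMISSIBLE
  (`⌊(P t)(e)⌋₊ = (P t)(e)` for `e ≥ B(P t) − 1`: a Hilbert polynomial takes natural values beyond Mumford's threshold) and such that at
  every field point `x` of `T` through `t` both letters of cohomology-and-base-change hold for the graph family with `P t`
  (★ `exists_isLocallyConstant_hilbertPolynomial_scheme` at the closed flat family `iΓ` — ★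
  `isClosedImmersion_graphFamily_of_over`, `flat_graphFamily_fst_of_over` of ★ `Morphisms/GraphFamilyBaseChange`).  This is sub-letter (C) `stub_IIb4C_decomposition` of the Hom-scheme skeleton (II-b (b4)) VERBATIM:
  the clopen level sets `{P = Q}` decompose the test scheme by the Hilbert polynomial of the graph (EGA III 7.9.11).

Cell hodgecm-mathlib, F-4 (II-b) Hom-scheme assembly (b4), B-p14 (g20).  Count-neutral capital: HC_CM is proved only modulo the 7 printed
citations until rung 0 closes; nothing here bears on it.

## References

* A. Grothendieck, *EGA III₂* (Publ. Math. IHÉS 17, 1963), 7.9.11. [EGAIII2]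
* R. Hartshorne, *Algebraic Geometry*, GTM 52 (1977), III Thm. 9.9 (p. 261). [Hartshorne1977]
* D. Mumford, J. Fogarty, F. Kirwan, *Geometric Invariant Theory* (3rd ed., 1994), Ch. 0 §5 (c) (p. 23). [MumfordFogartyKirwan1994]
-/

noncomputable section

set_option backward.isDefEq.respectTransparency false

open CategoryTheory CategoryTheory.Limits CategoryTheory.Abelian AlgebraicGeometry Polynomial
open Literature.Algebra.Homology Literature.Algebra.Homology.LaurentCech Literature.Algebra.Homology.OrderedCech
open Literature.AlgebraicGeometry.Modules Literature.AlgebraicGeometry.Modules.SerreTwist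

namespace Literature.AlgebraicGeometry.Morphisms

/-- **The Hilbert polynomial of the graph of a `T`-morphism is a locally constant, admissible function on `T`**, with both letters of
cohomology-and-base-change at every field point (= sub-letter (C) of the Hom-scheme skeleton): the graph family
`iΓ : Y_T ↪ 𝐏(ι; T)` is a closed FLAT family (★ `isClosedImmersion_graphFamily_of_over`, ★ `flat_graphFamily_fst_of_over`), so ★
`exists_isLocallyConstant_hilbertPolynomial_scheme` applies; admissibility of `P t` is read at the residue field of `t`, where `(P t)(e)`
is a dimension. [cite: EGAIII2, 7.9.11] [cite: Hartshorne1977, III Thm. 9.9 (p. 261)] [cite: MumfordFogartyKirwan1994, Ch. 0 §5 (c) (p. 23)] -/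
theorem graphFamily_hilbertPolynomial_decomposition : ∀ ⦃S Y X : Scheme.{0}⦄ [IsLocallyNoetherian S] (q : Y ⟶ S) (p : X ⟶ S)
    [Flat q] {ι : Type} (_ : 1 ≤ Nat.card ι) (jW : pullback q p ⟶ Morphisms.projectiveSpace ι S) [IsClosedImmersion jW]
    (_ : jW ≫ Morphisms.projectiveSpaceFst ι S = pullback.fst q p ≫ q)
    ⦃T : Scheme.{0}⦄ [IsLocallyNoetherian T] (v : T ⟶ S) (φ : pullback q v ⟶ pullback p v)
    (_ : φ ≫ pullback.snd p v = pullback.snd q v) (hw : pullback.fst q v ≫ q = (φ ≫ pullback.fst p v) ≫ p)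
    (iΓ : pullback q v ⟶ Morphisms.projectiveSpace ι T), iΓ ≫ Morphisms.projectiveSpaceFst ι T = pullback.snd q v →
    iΓ ≫ Morphisms.projectiveSpaceMap ι v = pullback.lift (pullback.fst q v) (φ ≫ pullback.fst p v) hw ≫ jW →
    ∃ P : T → ℚ[X], IsLocallyConstant P ∧
      (∀ t : T, ∀ e : ℕ, regularityBound (preHilbertPoly ℚ (Nat.card ι) 0) 0 (preHilbertPoly ℚ (Nat.card ι) 0 - P t) - 1 ≤ (e : ℤ) →
        ((⌊(P t).eval (e : ℚ)⌋₊ : ℕ) : ℚ) = (P t).eval (e : ℚ)) ∧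
      ∀ ⦃K : Type⦄ [Field K] ⦃X₀ : Scheme.{0}⦄ (k : X₀ ⟶ pullback q v) (f₀ : X₀ ⟶ Spec (CommRingCat.of K))
        (x : Spec (CommRingCat.of K) ⟶ T), IsPullback k f₀ (iΓ ≫ Morphisms.projectiveSpaceFst ι T) x →
        ∀ t : T, t ∈ Set.range x.base →
        ∀ e : ℕ, regularityBound (preHilbertPoly ℚ (Nat.card ι) 0) 0 (preHilbertPoly ℚ (Nat.card ι) 0 - P t) - 1 ≤ (e : ℤ) →
          Subsingleton (Ext.{1} (unitModule X₀) ((Scheme.Modules.pullback k).obj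
            (twistMod (iΓ ≫ pullback.snd (terminal.from T) (terminal.from (Morphisms.projectiveSpaceInt ι))) (unitModule _) e)) 1) ∧
          ((Module.finrank Γ(Spec (CommRingCat.of K), ⊤) (SecMod ((Scheme.Modules.pullback k).obj
            (twistMod (iΓ ≫ pullback.snd (terminal.from T) (terminal.from (Morphisms.projectiveSpaceInt ι))) (unitModule _) e))
            f₀.appTop.hom ⊤) : ℕ) : ℚ) = (P t).eval (e : ℚ) := by
  intro S Y X _ q p _ ι hn jW _ hjW T _ v φ _ hw iΓ h₁ h₂
  haveI : IsClosedImmersion iΓ := isClosedImmersion_graphFamily_of_over q p jW v φ hjW hw iΓ h₁ h₂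
  haveI : Flat (iΓ ≫ Morphisms.projectiveSpaceFst ι T) := flat_graphFamily_fst_of_over q v iΓ h₁
  obtain ⟨P, hP, hlet⟩ := exists_isLocallyConstant_hilbertPolynomial_scheme iΓ hn
  refine ⟨P, hP, fun t e he => ?_, hlet⟩
  -- admissibility at `t`: read the rank letter at the residue field of `t`
  have hx : t ∈ Set.range (T.fromSpecResidueField t).base := by
    rw [show Set.range (T.fromSpecResidueField t).base = {t} from T.range_fromSpecResidueField t]
    exact Set.mem_singleton t
  have H := IsPullback.of_hasPullback (iΓ ≫ Morphisms.projectiveSpaceFst ι T) (T.fromSpecResidueField t)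
  have h := (hlet (K := IsLocalRing.ResidueField (T.presheaf.stalk t)) (pullback.fst _ _) (pullback.snd _ _)
    (T.fromSpecResidueField t) H t hx e he).2
  rw [← h, Nat.floor_natCast]

end Literature.AlgebraicGeometry.Morphisms

end
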